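import Literature.NumberTheory.LFunctions.SaiasWeingartnerProofs
import Mathlib.Analysis.Normed.Module.FiniteDimension
import HarnessLib

/-!
# From one zero of a twisted Dirichlet series to `≫ T` zeros of the series (Booker–Thorne §4, step 2)

Topic `Literature/NumberTheory/LFunctions` (namespace `Literature.NumberTheory.LFunctions`).
Everything in this file is PROVED; there are no definitions and no named facts.

Booker–Thorne, *Zeros of `L`-functions outside the critical strip*, Algebra Number Theory 8
(2014), §4, step (2) of the proof of Theorem 2 ("Simultaneously approximating the `p^{-it_p}` by
`p^{-it}` for a common value of `t`, we use Rouché's theorem to find a zero of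
`P(L(s,π_1),…,L(s,π_n))` close to `σ + it` … As `P(s) = ∑ a_m m^{-s}` converges absolutely as a
Dirichlet series for `Re(s) > 1`, there is an integer `M > 0` with `∑_{m ≥ M} |a_m| m^{-σ₁} ≤ γ/3`
… by the joint uniform distribution of `p^{it}` for primes `p < M`, the set of `t ∈ ℝ` satisfying
`∑_{m<M} |a_m m^{-it} − b_m| m^{-σ₁} < γ/3` has positive lower density … By Rouché's theorem,
`P(s + it)` has a zero `s` with `|s − σ| < ρ`. Thus … `#{…} ≫ T`"), isolated from the automorphic
context as a statement about an arbitrary Dirichlet series `F(s) = ∑ a(n) n^{-s}`: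

* `TwistedZero.exists_many_zeros_of_twisted_zero` — if `∑ a(n) n^{-s}` converges absolutely for
  `Re s > σ₀`, some `a(n) ≠ 0` (`n ≥ 1`), and for a completely multiplicative unimodular twist
  `ε` the twisted series `G(s) = ∑ a(n) ε(n) n^{-s}` vanishes at the real point `σ`, where
  `σ - r > σ₀`, `r > 0`, then for all large `T` there are `≥ cT` distinct zeros `ρ` of `F` with
  `|Re ρ − σ| < r`, `|Im ρ| ≤ T`;
* `TwistedZero.hasLinearlyManyZeros_of_twisted_zero` — hence `HasLinearlyManyZeros F σ₁ σ₂`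
  (the tree's counting predicate of `SaiasWeingartner.lean`) whenever `σ₁ ≤ σ − r`, `σ + r ≤ σ₂`.

The proof is the printed one, run with the tree's tools from the Saias–Weingartner files: `G` is
analytic on `Re s > σ₀` and not identically zero near `σ` (injectivity of the `L`-series
transform, Mathlib `LSeries_eventually_eq_zero_iff'`), so `|G| ≥ γ > 0` on a small circle about
`σ` (`SWProof.exists_sphere_bound`); truncating the absolutely convergent series
(`norm_LSeries_twist_sub_le`) and approximating `ε(p)` by `p^{-it}` for the primes `p ≤ M` at a
relatively dense set of `t` (Kronecker, `SWTools.exists_relDense_prime_phases`) gives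
`|F(s + it) − G(s)| < γ/2` on the closed disc, whence a zero of `F(· + it)` inside (maximum
modulus, `SWTools.exists_zero_of_norm_lt`, in place of Rouché) and `≫ T` distinct zeros
(`SWProof.exists_many_zeros`).

## References

* [BookerThorne2014] A. R. Booker, F. Thorne, Algebra Number Theory 8 (2014), 2027–2042, §4,
  step (2), and §1, Remark 2 (arXiv:1306.6362, read).
* [SaiasWeingartner2009] E. Saias, A. Weingartner, Acta Arith. 140 (2009), §4 (the same step
  in degree one; tree: `SaiasWeingartnerProofs.lean`).
-/

noncomputable section

open Complex Filter Finset LSeries Metric Set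
open scoped Topology

namespace Literature.NumberTheory.LFunctions

namespace TwistedZero

/-! ### Twisted coefficients -/

/-- The `n`-th term of the series with coefficients `a(n) w(n)` has norm `‖w(n)‖` times that of
the `n`-th term of `a`. [folklore] -/
theorem norm_term_mul (a w : ℕ → ℂ) (s : ℂ) (n : ℕ) :
    ‖term (fun n ↦ a n * w n) s n‖ = ‖w n‖ * ‖term a s n‖ := by
  rcases eq_or_ne n 0 with rfl | hn
  · simp [term_zero]
  rw [norm_term_eq, norm_term_eq, if_neg hn, if_neg hn, norm_mul]
  ring

/-- Twisting by a unimodular completely multiplicative `u` preserves absolute convergence.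
[folklore] -/
theorem LSeriesSummable_mul_twist {a : ℕ → ℂ} {u : ℕ →*₀ ℂ} (hu : ∀ p, p.Prime → ‖u p‖ = 1)
    {s : ℂ} (ha : LSeriesSummable a s) : LSeriesSummable (fun n ↦ a n * u n) s := by
  have hn : Summable fun n ↦ ‖term a s n‖ := summable_norm_iff.2 ha
  refine Summable.of_norm_bounded hn fun n ↦ ?_
  rw [norm_term_mul]
  exact mul_le_of_le_one_left (norm_nonneg _) (SWTwist.norm_twist_le hu n)

/-- **Uniform comparison of two twists of an absolutely convergent series** (the truncation
step of [BookerThorne2014], §4): if `∑ ‖a(n)‖ n^{-σ₁} < ∞` with tail `∑_{n ≥ M} ≤ τ`, and the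
unimodular twists `u`, `v` satisfy `‖v(p) − u(p)‖ ≤ δ` for the primes `p ≤ M`, then
`‖L(a v, s) − L(a u, s)‖ ≤ M δ ∑ ‖a(n)‖ n^{-σ₁} + 2τ` for all `s` with `Re s ≥ σ₁`.
[cite: BookerThorne2014, §4, step (2)] -/
theorem norm_LSeries_twist_sub_le {a : ℕ → ℂ} {σ₁ : ℝ} (ha : LSeriesSummable a σ₁)
    {M : ℕ} {τ : ℝ} (hτ : ∑' n, ‖term a σ₁ (n + M)‖ ≤ τ)
    {u v : ℕ →*₀ ℂ} (hu : ∀ p, p.Prime → ‖u p‖ = 1) (hv : ∀ p, p.Prime → ‖v p‖ = 1)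
    {δ : ℝ} (hδ : 0 ≤ δ) (huv : ∀ p, p.Prime → p ≤ M → ‖v p - u p‖ ≤ δ)
    {s : ℂ} (hs : σ₁ ≤ s.re) :
    ‖LSeries (fun n ↦ a n * v n) s - LSeries (fun n ↦ a n * u n) s‖ ≤
      M * δ * (∑' n, ‖term a σ₁ n‖) + 2 * τ := by
  have hnorm : Summable fun n ↦ ‖term a σ₁ n‖ := summable_norm_iff.2 ha
  have hsv : LSeriesSummable (fun n ↦ a n * v n) s :=
    LSeriesSummable_mul_twist hv (ha.of_re_le_re (by simpa using hs))
  have hsu : LSeriesSummable (fun n ↦ a n * u n) s :=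
    LSeriesSummable_mul_twist hu (ha.of_re_le_re (by simpa using hs))
  -- the difference series
  obtain ⟨d, hd⟩ : ∃ d : ℕ → ℂ,
      d = fun n ↦ term (fun n ↦ a n * v n) s n - term (fun n ↦ a n * u n) s n := ⟨_, rfl⟩
  have hds : Summable d := by rw [hd]; exact Summable.sub hsv hsu
  have hdeq : ∀ n, d n = term (fun n ↦ a n * (v n - u n)) s n := by
    intro n
    rw [hd]
    dsimp only
    rw [← term_sub_apply]
    congr 1
    funext m
    simp only [Pi.sub_apply]
    ring
  have hmaj : ∀ n, ‖term a s n‖ ≤ ‖term a σ₁ n‖ := fun n ↦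
    norm_term_le_of_re_le_re a (by simpa using hs) n
  have hd2 : ∀ n, ‖d n‖ ≤ 2 * ‖term a σ₁ n‖ := by
    intro n
    rw [hdeq, norm_term_mul]
    refine mul_le_mul ?_ (hmaj n) (norm_nonneg _) zero_le_two
    calc ‖v n - u n‖ ≤ ‖v n‖ + ‖u n‖ := norm_sub_le _ _
      _ ≤ 1 + 1 := add_le_add (SWTwist.norm_twist_le hv n) (SWTwist.norm_twist_le hu n)
      _ = 2 := by norm_num
  have hdM : ∀ n ∈ range M, ‖d n‖ ≤ M * δ * ‖term a σ₁ n‖ := by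
    intro n hn
    rw [Finset.mem_range] at hn
    rw [hdeq, norm_term_mul]
    refine mul_le_mul ?_ (hmaj n) (norm_nonneg _) (by positivity)
    calc ‖v n - u n‖ ≤ n * δ := SWApprox.norm_twist_sub_twist_le hu hv hδ huv hn.le
      _ ≤ M * δ := mul_le_mul_of_nonneg_right (by exact_mod_cast hn.le) hδ
  -- split the sum at `M`
  have hdiff : LSeries (fun n ↦ a n * v n) s - LSeries (fun n ↦ a n * u n) s = ∑' n, d n := by
    rw [hd]
    exact (Summable.tsum_sub hsv hsu).symm
  rw [hdiff, ← hds.sum_add_tsum_nat_add M]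
  refine (norm_add_le _ _).trans (add_le_add ?_ ?_)
  · refine (norm_sum_le _ _).trans ((sum_le_sum hdM).trans ?_)
    rw [← mul_sum]
    refine mul_le_mul_of_nonneg_left ?_ (by positivity)
    exact hnorm.sum_le_tsum _ (fun n _ ↦ norm_nonneg _)
  · have htail : Summable fun n ↦ ‖term a σ₁ (n + M)‖ :=
      (summable_nat_add_iff (f := fun n ↦ ‖term a σ₁ n‖) M).2 hnorm
    calc ‖∑' n, d (n + M)‖ ≤ ∑' n, 2 * ‖term a σ₁ (n + M)‖ :=
          tsum_of_norm_bounded (htail.mul_left 2).hasSum fun n ↦ hd2 _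
      _ = 2 * ∑' n, ‖term a σ₁ (n + M)‖ := tsum_mul_left
      _ ≤ 2 * τ := by linarith

/-! ### The twisted series is analytic and not identically zero -/

/-- **The twisted series `G(s) = ∑ a(n) ε(n) n^{-s}` is analytic on `Re s > σ₀` and not locally
zero at any point there**, provided `∑ a(n) n^{-s}` converges absolutely for `Re s > σ₀` and
some `a(n) ≠ 0`, `n ≥ 1` (identity principle on the half-plane and injectivity of the
`L`-series transform). [folklore] -/
theorem analyticOnNhd_and_eventually_ne_zero {a : ℕ → ℂ} {σ₀ : ℝ}
    (ha : ∀ x : ℝ, σ₀ < x → LSeriesSummable a x) (hne : ∃ n, n ≠ 0 ∧ a n ≠ 0)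
    {ε : ℕ →*₀ ℂ} (hε : ∀ p, p.Prime → ‖ε p‖ = 1) :
    AnalyticOnNhd ℂ (LSeries fun n ↦ a n * ε n) {s : ℂ | σ₀ < s.re} ∧
      ∀ s₀ : ℂ, σ₀ < s₀.re → ∀ᶠ s in 𝓝[≠] s₀, LSeries (fun n ↦ a n * ε n) s ≠ 0 := by
  set G : ℂ → ℂ := LSeries fun n ↦ a n * ε n with hG
  set U : Set ℂ := {s : ℂ | σ₀ < s.re} with hU
  have hsumm : ∀ x : ℝ, σ₀ < x → LSeriesSummable (fun n ↦ a n * ε n) x := fun x hx ↦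
    LSeriesSummable_mul_twist hε (ha x hx)
  have habs : abscissaOfAbsConv (fun n ↦ a n * ε n) ≤ σ₀ :=
    abscissaOfAbsConv_le_of_forall_lt_LSeriesSummable fun y hy ↦ hsumm y (by simpa using hy)
  have hGan : AnalyticOnNhd ℂ G U :=
    (LSeries_analyticOnNhd _).mono fun s hs ↦ lt_of_le_of_lt habs (by exact_mod_cast hs)
  refine ⟨hGan, fun s₀ hs₀ ↦ ?_⟩
  rcases (hGan s₀ hs₀).eventually_eq_zero_or_eventually_ne_zero with h0 | hne'
  · exfalso
    have hEq : EqOn G 0 U := hGan.eqOn_zero_of_preconnected_of_eventuallyEq_zero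
      (convex_halfSpace_re_gt σ₀).isPreconnected hs₀ h0
    have hev : (fun x : ℝ ↦ LSeries (fun n ↦ a n * ε n) x) =ᶠ[atTop] 0 := by
      filter_upwards [eventually_gt_atTop σ₀] with x hx
      exact hEq (show σ₀ < (x : ℂ).re by simpa using hx)
    rcases LSeries_eventually_eq_zero_iff'.1 hev with hzero | htop
    · obtain ⟨N, hN0, hN⟩ := hne
      have h1 := hzero N hN0
      have hε0 : ε N ≠ 0 :=
        norm_ne_zero_iff.1 (by rw [SWTwist.norm_twist hε hN0]; exact one_ne_zero)
      exact hN ((mul_eq_zero.1 h1).resolve_right hε0)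
    · exact absurd htop (ne_top_of_le_ne_top (EReal.coe_ne_top σ₀) habs)
  · exact hne'

/-! ### The theorem -/

/-- **Booker–Thorne §4, step (2): `≫ T` zeros near `σ` from one zero of a twist at `σ`.** Let
`F(s) = ∑ a(n) n^{-s}` converge absolutely for `Re s > σ₀`, with some `a(n) ≠ 0` (`n ≥ 1`), and
let `ε` be a completely multiplicative unimodular twist with `∑ a(n) ε(n) n^{-σ} = 0` at a real
`σ` with `σ − r > σ₀`, `r > 0`. Then for all large `T` there are at least `cT` distinct zeros
`ρ` of `F` with `|Re ρ − σ| < r` and `|Im ρ| ≤ T`. [cite: BookerThorne2014, §4, step (2)] -/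
theorem exists_many_zeros_of_twisted_zero {a : ℕ → ℂ} {σ₀ : ℝ}
    (ha : ∀ x : ℝ, σ₀ < x → LSeriesSummable a x) (hne : ∃ n, n ≠ 0 ∧ a n ≠ 0)
    {ε : ℕ →*₀ ℂ} (hε : ∀ p, p.Prime → ‖ε p‖ = 1)
    {σ r : ℝ} (hr : 0 < r) (hσ : σ₀ < σ - r)
    (hzero : LSeries (fun n ↦ a n * ε n) σ = 0) :
    ∃ c : ℝ, 0 < c ∧ ∃ T₀ : ℝ, ∀ T : ℝ, T₀ ≤ T →
      ∃ Z : Finset ℂ, c * T ≤ Z.card ∧ ∀ z ∈ Z, |z.re - σ| < r ∧ |z.im| ≤ T ∧ LSeries a z = 0 := by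
  classical
  set G : ℂ → ℂ := LSeries fun n ↦ a n * ε n with hG
  obtain ⟨hGan, hGne⟩ := analyticOnNhd_and_eventually_ne_zero ha hne hε
  -- real parts on discs about `σ`
  have hre_of_mem : ∀ {ρ : ℝ} {s : ℂ}, s ∈ closedBall (σ : ℂ) ρ → σ - ρ ≤ s.re := by
    intro ρ s hs
    have h1 : |s.re - σ| ≤ ρ := by
      have := abs_re_le_norm (s - σ)
      rw [sub_re, ofReal_re] at this
      rw [mem_closedBall, dist_eq_norm] at hs
      linarith
    have := (abs_le.1 h1).1
    linarith
  -- a good circle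
  have hcontG : ∀ w : ℂ, dist w σ < r → ContinuousAt G w := by
    intro w hw
    refine (hGan w ?_).continuousAt
    show σ₀ < w.re
    have := hre_of_mem (mem_closedBall.2 hw.le)
    linarith
  obtain ⟨ρ, hρ0, hρr, γ, hγ, hγle⟩ :=
    SWProof.exists_sphere_bound hr hcontG (hGne σ (by simpa using (by linarith : σ₀ < σ)))
  -- truncation of the absolutely convergent series at `σ₁ = σ - r`
  set σ₁ : ℝ := σ - r with hσ₁
  have ha₁ : LSeriesSummable a σ₁ := ha σ₁ hσ
  have hnorm : Summable fun n ↦ ‖term a σ₁ n‖ := summable_norm_iff.2 ha₁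
  set S : ℝ := ∑' n, ‖term a σ₁ n‖ with hS
  have hS0 : 0 ≤ S := tsum_nonneg fun n ↦ norm_nonneg _
  have htail := (tendsto_order.1 (tendsto_sum_nat_add fun n ↦ ‖term a σ₁ n‖)).2 (γ / 8)
    (by positivity)
  rw [eventually_atTop] at htail
  obtain ⟨M, hM⟩ := htail
  have hMtail : ∑' n, ‖term a σ₁ (n + M)‖ ≤ γ / 8 := (hM M le_rfl).le
  set δ : ℝ := γ / (8 * (M * S + 1)) with hδ
  have hMS : 0 < (M : ℝ) * S + 1 := by positivity
  have hδ0 : 0 < δ := by positivity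
  have hδS : M * δ * S ≤ γ / 8 := by
    rw [hδ]
    rw [show (M : ℝ) * (γ / (8 * (M * S + 1))) * S = γ / 8 * (M * S / (M * S + 1)) by
      field_simp]
    exact mul_le_of_le_one_right (by positivity)
      ((div_le_one hMS).2 (by linarith))
  -- Kronecker
  obtain ⟨L, hL, hdense⟩ := SWTools.exists_relDense_prime_phases M (fun p ↦ ε p) hε hδ0
  -- one zero in every window
  have hkey : ∀ s₀ : ℝ, ∃ w : ℂ, LSeries a w = 0 ∧ |w.re - σ| < r ∧ |w.im - s₀| ≤ L + r := by
    intro s₀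
    obtain ⟨t, ht, hclose⟩ := hdense s₀
    obtain ⟨ut, -, hut1, hutn⟩ := SWTwist.exists_shift_twist t
    have hclose' : ∀ p, p.Prime → p ≤ M → ‖ut p - ε p‖ ≤ δ := by
      intro p hp hpM
      rw [hutn p hp.ne_zero]
      exact (hclose p hp hpM).le
    have happ : ∀ s ∈ closedBall (σ : ℂ) ρ,
        ‖LSeries (fun n ↦ a n * ut n) s - G s‖ < γ / 2 := by
      intro s hs
      have hs₁ : σ₁ ≤ s.re := by
        have := hre_of_mem hs
        rw [hσ₁]; linarith
      have h := norm_LSeries_twist_sub_le ha₁ hMtail hε hut1 hδ0.le hclose' hs₁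
      calc ‖LSeries (fun n ↦ a n * ut n) s - G s‖ ≤ M * δ * S + 2 * (γ / 8) := h
        _ < γ / 2 := by linarith
    -- `Ψ(s) = F(s + it)`
    set Ψ : ℂ → ℂ := fun s ↦ LSeries a (s + t * I) with hΨdef
    have hΨeq : ∀ s, Ψ s = LSeries (fun n ↦ a n * ut n) s := fun s ↦
      SWTwist.LSeries_add_eq_twist a s t hutn
    have habsa : abscissaOfAbsConv a ≤ σ₀ :=
      abscissaOfAbsConv_le_of_forall_lt_LSeriesSummable fun y hy ↦ ha y (by simpa using hy)
    have hΨdiff : ∀ s ∈ closedBall (σ : ℂ) ρ, DifferentiableAt ℂ Ψ s := by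
      intro s hs
      have hre : abscissaOfAbsConv a < ((s + t * I).re : EReal) := by
        refine lt_of_le_of_lt habsa ?_
        have h1 := hre_of_mem hs
        have h2 : (s + t * I).re = s.re := by simp
        rw [h2]
        exact_mod_cast (by linarith : σ₀ < s.re)
      have hg : DifferentiableAt ℂ (LSeries a) (s + t * I) := (LSeries_analyticOnNhd a _ hre).differentiableAt
      have hf : DifferentiableAt ℂ (fun s : ℂ ↦ s + t * I) s := differentiableAt_id.add_const _
      exact hg.comp s hf
    have hΨσ : ‖Ψ σ‖ < γ / 2 := by
      have hσmem : (σ : ℂ) ∈ closedBall (σ : ℂ) ρ := mem_closedBall_self hρ0.le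
      rw [hΨeq σ]
      have := happ σ hσmem
      have hGσ : G σ = 0 := hzero
      rw [hGσ, sub_zero] at this
      exact this
    have hΨsphere : ∀ s ∈ sphere (σ : ℂ) ρ, γ / 2 ≤ ‖Ψ s‖ := by
      intro s hs
      have hs' : s ∈ closedBall (σ : ℂ) ρ := sphere_subset_closedBall hs
      rw [hΨeq s]
      have h1 := happ s hs'
      have h2 := hγle s hs
      have h3 := norm_sub_norm_le (G s) (LSeries (fun n ↦ a n * ut n) s)
      rw [norm_sub_rev] at h1
      linarith
    obtain ⟨z₁, hz₁, hΨz₁⟩ := SWTools.exists_zero_of_norm_lt hρ0 hΨdiff hΨσ hΨsphere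
    refine ⟨z₁ + t * I, hΨz₁, ?_, ?_⟩
    · have := abs_re_le_norm (z₁ - σ)
      rw [sub_re, ofReal_re] at this
      rw [mem_ball, dist_eq_norm] at hz₁
      simp only [add_re, mul_re, ofReal_re, I_re, mul_zero, ofReal_im, I_im, mul_one, sub_self,
        add_zero]
      linarith
    · have him : |z₁.im| < r := by
        have := abs_im_le_norm (z₁ - σ)
        rw [sub_im, ofReal_im, sub_zero] at this
        rw [mem_ball, dist_eq_norm] at hz₁
        linarith
      have : (z₁ + t * I).im - s₀ = z₁.im + (t - s₀) := by
        simp only [add_im, mul_im, ofReal_re, I_im, ofReal_im, I_re, mul_one, mul_zero, add_zero]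
        ring
      rw [this]
      have := abs_add_le z₁.im (t - s₀)
      linarith
  exact SWProof.exists_many_zeros (by positivity : (0 : ℝ) ≤ L + r) hkey

/-- **Booker–Thorne §4, step (2), in strip form**: under the hypotheses of
`exists_many_zeros_of_twisted_zero`, `F = ∑ a(n) n^{-s}` has `≫ T` distinct zeros in every strip
`σ₁ < Re s < σ₂` with `σ₁ ≤ σ − r`, `σ + r ≤ σ₂` (`HasLinearlyManyZeros`, the counting predicate of
`SaiasWeingartner.lean`). [cite: BookerThorne2014, §4, step (2), and §1, Remark 2] -/
theorem hasLinearlyManyZeros_of_twisted_zero {a : ℕ → ℂ} {σ₀ : ℝ}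
    (ha : ∀ x : ℝ, σ₀ < x → LSeriesSummable a x) (hne : ∃ n, n ≠ 0 ∧ a n ≠ 0)
    {ε : ℕ →*₀ ℂ} (hε : ∀ p, p.Prime → ‖ε p‖ = 1)
    {σ r : ℝ} (hr : 0 < r) (hσ : σ₀ < σ - r)
    (hzero : LSeries (fun n ↦ a n * ε n) σ = 0) {σ₁ σ₂ : ℝ} (h₁ : σ₁ ≤ σ - r)
    (h₂ : σ + r ≤ σ₂) : HasLinearlyManyZeros (LSeries a) σ₁ σ₂ :=
  HasLinearlyManyZeros.of_abs_sub_lt h₁ h₂ (exists_many_zeros_of_twisted_zero ha hne hε hr hσ hzero)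

end TwistedZero

end Literature.NumberTheory.LFunctions
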